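import Summits.QuantumFields.BalabanUV.T4Continuum.Support.ShellMeasureLandauEndAssembledDecayReachBoxV6
import Summits.QuantumFields.BalabanUV.T4Continuum.Support.ShellMeasureLandauCfBoxLocal

/-!
v6 RE-ROOT (owner R-ne7cp1-g37-1 (c3) «THE MIDDLE», unit `b2b-balaban-t4-ne7c-formalise-leaf-03` gen 9; chain suffix `V6`∕`_v6`,
R-ne7cp1-g37-3 (b)): THIS MODULE IS `ShellMeasureLandauEndAssembledDecayCf` (ROW S99 f3b, leaf-07-g9) REGENERATED MECHANICALLY over link 2 `ShellMeasureLandauEndAssembledDecayReachBoxV6` — the chain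
rooted at leaf-07-g10's S112 f3 `ShellMeasureLandauEndRayStokesAssembledDecayV6` (the Wilson budgets `hqW hk` in print's (53)–(54)
field-size shape, S112; the 𝓔-leg read on the w-tuple's pinned dress, S113 = leaf-01-g11's `ShellMeasureRayTermsPinnedLandauW`) — by
`g9/src/relink/relink.py` (the old surgery re-applied to the new host; ONE BY-NAME call; conclusion = the host's).  BINDER DIFF vs `ShellMeasureLandauEndAssembledDecayCf` (`linkdiff.py` on the bytes):
LEAVE = `Se Se' h52loce ϖe₁ ϖe₂ hϖe₁ hϖe₂ r₀e hreache Λe 𝔄 δ' ϖ hδ' hϖ 𝒵e ℬe 𝒢e W𝒱e B₀e C₄e a₃e be h𝒢e hWe hB₀e hC₄e hbe H₁e hH₁e Φe rΦe hΦde hΦ0e hΦbe hSre ιe hιe He hHe`;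
ENTER = `hϖ0 hB𝒢w hBH₁w hBHw hιew`; TYPE-CHANGED = `hqW hk hdome hselfe hcontre hqe hRCe Ef hEb supp hblind hdepth hK hcoupE hElb₁ hRdict`; conclusion = the
host's re-spelled slot constant.  HAND-SPOT (announced l.22925∕l.23411): INSTANTIATION mode — the 𝓔-leg's pinned Landau pair is now the w-tuple's box-local pair `hRw` read through the w-tuple's OWN pins `ϖw ∘ pos′`∕`ϖw ∘ posx` at rate `δw` with reach `hreachC` (`ShellMeasureLandauCfPinned.conj_binders_of_local`), `Ce V :=` the pin-conjugate of `landauCfBox P.L (Ubg V) k Sw Sw′ (landauRad d L)`, `C₂e := C2cov d·e^{2δw·rC}`, `RCe := landauRad d L`; hence the old module's e-data `Se Se′ h52loce ϖe₁ ϖe₂ hϖe₁ hϖe₂ r₀e hreache` NEVER ENTER (one exponent field, R-ne7cp1-g37-1 (c1)).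
HONEST (c3): re-wiring of OUR typed chain; nothing of Bałaban's asserted, cited or discharged; every CONTENT row stays displayed; NOTHING
in the countdown moves; NE7c NOT PRINTED, NOT PROVED; spine 0∕9.  THE OLD MODULE's DOCSTRING FOLLOWS VERBATIM FOR PROVENANCE (read
«imports X» as «imports X·V6»; its LEAVING∕ENTERING lists describe the OLD step, unchanged relative to the v6 host).
# `T4Continuum.ShellMeasureLandauEndAssembledDecayCf` — row S99 f3b: THE MOST-ASSEMBLED ONE-SLOT END OF RECORD (S80 f6
# `ShellMeasureLandauEndAssembledDecayReachBox.slotAC_realized_su2_landauChart_assembled_decay_of_core_collar`) FIRED WITH ITS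
# THREE LANDAU-CORRECTION LETTERS SUPPLIED BY THE TREE's `C_k` — R11 (`Cf`∕`Cw`∕`Ce` + 9 class-T hypotheses + the two reality
# rows + `hlocC`) DISCHARGED; in their place the GLOBAL minimiser's located plaquette regularity (w∕e, two hypotheses) and
# level-free numbers — NOTHING for the localized tuple
(cell `pub-balaban`, sub-cell `t4`, spine estimate NE7c (node U5b); NE7c ROUND-2 crew `t4-ne7c-formalise-*`, seat
`b2b-balaban-t4-ne7c-formalise-leaf-07` gen 9; owner-table row **S99** «R11 LOCATED — S64 ON THE BOXES + THE Cf-SLOT FIRED»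
(R-ne7cp1-g35-1 (b), journal l.20233; f3 «on f2's ACCEPT, ≤ 400 l.», acceptance test (x-S99)); ADDITIVE — imports S80 f6
`ShellMeasureLandauEndAssembledDecayReachBox` + f3a `ShellMeasureLandauCfBoxLocal` ONLY; [folklore]; 0 `def`, 0 `def … : Prop`,
0 sorry, 0 citation tags.)

HONEST FRAMING.  Finite four-torus programme, rung (B)+1 only — NOT infinite volume, NOT a mass gap, NOT the Clay
problem, NOT summit progress; (B), `BetaPertHyp`, (B^μ) not consumed.  NE7c (`T4IndicatorShell.ShellWeightBound`) is NOT
PRINTED and NOT PROVED; «NE7c ⇐ the named binders» (trigger c3); (M1) realized ≠ NE7c.  Nothing printed is asserted: equation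
numbers LOCATE displayed SHAPES.  HONEST DEPENDENCY (cell): continuum YM on T⁴ ⇐ BetaPertH ∧ nine spine estimates (0/9 proved);
BetaPertH ⇐ (D1) ∧ (D4) ∧ CAP+tail; G-an2-4 gates asym, D1 and NE2/3/4.

(x-S99) — WHAT IS DISCHARGED AND WHAT STAYS DISPLAYED, PER TUPLE (owner R-ne7cp1-g35-1 (b)).
* u-tuple (LOCALIZED classifier scheme; `hudict`'s plaquette variables are `holOf (ℓs p) Z` of the exponent field ALONE, `= 1`
  at the centre — WALL §2b R04): `𝒴′ := 𝔸^{Sf}`, `𝒳 := 𝔸^{Sf′}`, `Cf V := (ball 0 RC).indicator (landauCf L 1 k Sf Sf′)`,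
  `C₂ := C2cov d`, `RC := landauRad d L`, `𝓡𝒴′∕𝓡𝒳 := skewPi`; `hC₂ hCq hCd hCr h𝓡𝒳` DISCHARGED by f1 §5
  `landauCorrection_real_binders_flat` — NO reading from `hcore`∕`hcollar` is needed and NONE is used: NOTHING enters.
* w-tuple (GLOBAL scheme, flat pi-types, Wilson weight; frozen prefactors `B_p ≠ 1`, N-ne7cp1-g31-2): `Λw′ := Sw`, `Λx := Sw′`,
  `𝔄′ = 𝔅 := 𝔸`, `Cw V := landauCfBox L (Ubg V) k Sw Sw′ RC` (f3a: cut off PER OUTPUT BOND on its own box), `C₂w := C2cov d`,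
  `RCw := landauRad d L`, `NC c′ b′ :≡ b′ ⊂ B^k(c′₋) ∪ B^k(c′₊)`, `𝓡𝒴w′∕𝓡𝒳w := skewPi`; `hC₂w hCqw hCdw hlocC hCrw h𝓡𝒳w`
  DISCHARGED by f3a `landauCfBox_real_binders_local` ∕ `landauCfBox_local`.  STAYS DISPLAYED: the background `Ubg V` on `ℤᵈ`
  (unitary-valued — structural) and **`h52locw`**: its plaquette regularity ON THE BOXES of `Sw′` only
  ([Balaban1985Averaging] (52) ∕ B11 Thm 1, (19)–(21) TYPE for the global minimiser — ONE hypothesis of printed TYPE, class T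
  until node O reads it off the co-tests); the reach `hreachC` now reads the concrete stencil ([R], as before).
* e-tuple (GLOBAL scheme, pinned instance, non-Wilson terms): `𝒴e′ := WSup (pinW δ′ ϖe₁) 1 𝔸` on `Se`, `𝒳e := WSup (pinW δ′
  ϖe₂) 1 𝔸` on `Se′`, `Ce V :=` CfP's conjugate `toPiL⁻¹ ∘ landauCf L (Ubg V) k Se Se′ ∘ toPiL`, `C₂e := C2cov d·e^{2δ′r₀e}`,
  `RCe := landauRad d L`; `hC₂e hCqe hCde` DISCHARGED in the proof by ONE call of CfP's generic `conj_binders_of_local` over f1's LOCATED pair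
  `landauCorrection_binders_local` and S68 (b) `landauCf_congr`.  STAYS DISPLAYED: **`h52loce`** (the
  same background's regularity on the boxes of `Se′` — ONE hypothesis, class T), the two pin profiles `ϖe₁ ϖe₂ ≥ 0` and CfP's
  reach `hreache` with `r₀e` ([R]).
* shared, class D: `0 < α₀`, `C₀α₀ ≤ 1∕3`, `4α₀ ≤ c₂′(d,L)`, `4·O1cov(d)·α₀ ≤ 1∕3` (print's «α₀ ≦ c₄(d, L)», level-free); the
  coupling rows `h18 h3R hqw hRCw hk hqe hRCe hcoupE hs₁ ha hma` are S80 f6's VERBATIM with the constants substituted (still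
  binders, now between explicit level-free numbers); [dict]: `k` = the slot's level, `Ubg V` = the global minimiser about the
  section's centre read on `ℤᵈ`, the slots = (44)'s `C_j` on the block's bonds (node O).
Everything else is S80 f6's VERBATIM (box, comb, γ3 core∕collar readings, the three schemes' other letters, decay kernels, Wilson
and non-Wilson legs, (S78), END-I-facing numbers); CONCLUSION IDENTICAL with `C₂w·RCw ↦ C2cov d·landauRad d L`,
`C₂e ↦ C2cov d·e^{2δ′r₀e}`.  CENSUS CONSEQUENCE (the owner's to rule): R11's 18 names ∕ 9 [T] hypotheses (+ `hCr hCrw hlocC` of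
rows R18∕R22) LEAVE the three tuples; 2 located-regularity hypotheses [T] + 4 numbers [D] + pins∕reach [R] ENTER.
-/

noncomputable section

open Set Metric NormedSpace MeasureTheory Function

namespace Summit.QuantumFields.BalabanUV.T4Continuum.ShellMeasureLandauEndAssembledDecayCfV6

open scoped ENNReal
open Literature.MathematicalPhysics.QuantumFieldTheory.Balaban1983to89
open B11Prop6Scheme (Prop4Hyp)
open GaugeField (GaugeInvariant)
open T4ShellMeasure (SlotAntiConcentration)
open T4CubePoincare (cube)
open T4CubeChartGnomonic (SU2)
open T4CubeChartExp (expFibreChart)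
open T4TreeGaugeFixing (NoClosedLoop fixTo noClosedLoop_combBonds)
open T4ShellMeasurePlaquette (expTail₂)
open ShellMeasureLevelAssembly (classifier)
open ShellMeasureMultiGridNorms (WSup)
open ShellMeasurePinnedNorm (pinW kerOpPin)
open ShellMeasureMultiGridNorms.WSup (toPiL)
open ShellMeasureLandauHolonomy (solAt landauExp)
open ShellMeasureLandauHolonomyChart (holOf cplx)
open ShellMeasureLandauHolonomySkew (readOutReal)
open ShellMeasureRayTermsPinnedLandauW (hE_landau_chartRay_pinned_w)
open ShellMeasureRayLogIntegral (rayBound_of_logIntegral rayBound_add)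
open ShellMeasureLandauEndFinal (slotAC_realized_su2_landauChart_final)
open ShellMeasureLandauEndRayStokesAssembled (wilsonProfile_nonneg)
open ShellMeasureDecayKernelSums (kerOp)
open ShellMeasureLandauWilsonSquaresKernelsSchwarzField (hE_landau_wilsonSquares_located_schwarz_of_decay_field)
open ShellMeasureRayTermsPinnedLandau (hE_landau_chartRay_pinned completeSpace_wsup)
open ShellMeasureLandauEndWindowRestrictRel (slotAC_realized_su2_landauChart_final_of_reach')
open T4AxialGaugeSmallField (boxPlaqs boxBonds)
open T4AxialGaugeFixing (combBonds)
open ShellMeasureWindowReachCollar (hreach'_of_core_collar)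
open ShellMeasureLandauEndWindowReach (reach_family_inhabited)
open ShellMeasureLevelZeroBoxWitness (toyParams blockBonds boxPlaqF)
open ShellMeasureLandauEndAssembledDecayReachV6 (slotAC_realized_su2_landauChart_assembled_decay_v6_of_reach')
open B7Prop2Explicit (C0 c2' unitaryUnits avgClosed_unitaryUnits)
open B7Prop1Local (pdevOn loK bondHiK)
open B7Prop5Flat (BondIn)
open ShellMeasureAverageProp4General (C1cov O1cov C2cov C1cov_pos)
open ShellMeasureLandauCorrectionB7 (landauCf landauRad)
open ShellMeasureLandauCorrectionReal (skewPi isClosed_skewPi)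
open ShellMeasureLandauCfBoxLocal (landauCfBox landauCfBox_local landauCfBox_real_binders_local)
open ShellMeasureLandauCorrectionB7Local (landauCorrection_real_binders_flat landauCorrection_binders_local)
open ShellMeasureAverageLocality148 (landauCf_congr)
open ShellMeasureLandauCfPinned (conj_binders_of_local C2cov_nonneg)
open ShellMeasureLandauEndAssembledDecayReachBoxV6 (slotAC_realized_su2_landauChart_assembled_decay_v6_of_core_collar)

section Box

open scoped Matrix.Norms.L2Operator

variable {P : Params} {j : ℕ} [DecidableEq (PBond P j)]
variable {n : Type*} [Fintype n] [DecidableEq n] [Nonempty n]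
variable {𝒴 𝒵 ℬ : Type*} [NormedAddCommGroup 𝒴] [NormedSpace ℂ 𝒴] [CompleteSpace 𝒴]
  [NormedAddCommGroup 𝒵] [NormedSpace ℂ 𝒵] [NormedAddCommGroup ℬ] [NormedSpace ℂ ℬ]
variable {𝔸 : Type*} [CStarAlgebra 𝔸] [Nontrivial 𝔸]

/-- **THE MOST-ASSEMBLED ONE-SLOT END WITH R11 SUPPLIED** — S80 f6 `…_assembled_decay_of_core_collar` with its three
Landau-correction letters := the tree's `C_k` (u: flat, cut off on the ball; w: box-local cut-off; e: CfP's pinned conjugate),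
`C₂ = C₂w := C2cov d`, `C₂e := C2cov d·e^{2δ′r₀e}`, `RC = RCw = RCe := landauRad d L`, real structures `skewPi`, stencil
`NC :≡` the boxes; R11's binders DISCHARGED (f1 §5, f3a), the w∕e background's located regularity `h52locw`∕`h52loce` + four
level-free numbers + the e-pins∕reach DISPLAYED instead (header (x-S99)); everything else VERBATIM; conclusion identical.
CONDITIONAL on every binder; readings NOT asserted; NOT Bałaban's minimiser (node O); (M1) realized ≠ NE7c. [folklore] -/
theorem slotAC_realized_su2_landauChart_assembled_decay_v6_cfB7
    -- the BOX `[lo, hi]` (the block `□^{∼4}`: `nb` unit steps per direction, non-wrapping on the torus) and its axial comb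
    {lo hi : Fin P.d → ℤ} {nb : ℕ} (hn : ∀ κ, hi κ ≤ lo κ + nb) (hN : ∀ κ, hi κ - lo κ < P.sitesPerDir j)
    (Λ : Finset (PBond P j)) (hΛbox : ∀ b ∈ Λ, b ∈ boxBonds lo hi) (hΛcomb : Disjoint Λ (combBonds lo hi)) {m₀ : ℕ}
    (e : ↥Λ × Fin 3 ≃ Fin m₀) {S : ℝ} (hS : 0 < S) (hSπ : 3 * S ^ 2 < Real.pi ^ 2) {F : GaugeField P j SU2 → ℝ≥0∞}
    (hF : Measurable F) (hFi : GaugeInvariant F) {u : GaugeField P j SU2 → ℝ} (hu : Measurable u)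
    (hui : GaugeInvariant u) {ι : Type*} {Pu : Finset ι} (hPu : Pu.Nonempty)
    (W : GaugeField P j SU2 → Set (Fin m₀ → ℝ)) (Jco : GaugeField P j SU2 → (Fin m₀ → ℝ) → ℝ≥0∞) {δ ρ β : ℝ}
    (𝒢 : GaugeField P j SU2 → (𝒵 →L[ℂ] 𝒴)) (W𝒱 : GaugeField P j SU2 → 𝒴 → 𝒵) {B₀ C₄ a₃ ε₄ : ℝ}
    (h𝒢 : ∀ V f, ‖𝒢 V f‖ ≤ B₀ * ‖f‖) (hW : ∀ V, Prop4Hyp (W𝒱 V) C₄ a₃) (hB₀ : 0 < B₀) (hC₄ : 0 ≤ C₄) (hε₄ : 0 ≤ ε₄)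
    {dL C₁ B₃ ε₁ : ℝ} (hdL : 0 ≤ dL) (hC₁ : 0 ≤ C₁) (hε₁ : 0 ≤ ε₁) (hB₃ : dL ≤ B₃) (h1 : 2 * B₀ * C₁ * B₃ * ε₁ ≤ ε₄)
    (h2 : 4 * ε₄ ≤ a₃) (h3 : 16 * B₀ * C₄ * ε₄ ≤ 1) (H₁ : GaugeField P j SU2 → (ℬ →L[ℂ] 𝒴))
    (hH₁ : ∀ V B, ‖H₁ V B‖ ≤ B₀ * ‖B‖) (Φ : GaugeField P j SU2 → (Fin m₀ → ℂ) → ℬ) {rΦ : ℝ}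
    (hΦd : ∀ V, DifferentiableOn ℂ (Φ V) (ball 0 rΦ)) (hΦ0 : ∀ V, Φ V 0 = 0)
    (hΦ : ∀ V, ∀ z ∈ ball (0 : Fin m₀ → ℂ) rΦ, ‖Φ V z‖ < 2 * dL * C₁ * ε₁) (hSr : S < rΦ)
    -- ══ R11 SUPPLIED (row S99, γ14): the THREE Landau-correction letters ARE the tree's `C_k` of [B7] Prop. 4 in the
    -- `A`-currency (S64 `landauCf`), all with `C₂ := C2cov d`, `RC := landauRad d L`: u-tuple (LOCALIZED, flat background —
    -- its plaquette variables are words of the exponent field alone) `Cf V := (ball 0 RC).indicator (C_k(1, ·))`, NOTHING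
    -- displayed in its place; w-tuple (GLOBAL minimiser, flat pi-types) `Cw V := landauCfBox L (Ubg V) k Sw Sw′ RC` (cut off
    -- PER OUTPUT BOND on its box — exact locality `hlocC` by `landauCfBox_local`); e-tuple (GLOBAL minimiser, pinned) `Ce V :=`
    -- CfP's conjugate of `C_k(Ubg V, ·)` with `C₂e := C2cov d·e^{2δ′r₀e}`.  `hC₂ hCq hCd hCr h𝓡𝒳 ∕ hC₂w hCqw hCdw hlocC hCrw h𝓡𝒳w
    -- ∕ hC₂e hCqe hCde` DISCHARGED (f1 §5, f3a §2–§3).  DISPLAYED IN THEIR PLACE (w∕e only): the global minimiser's background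
    -- `Ubg V` on `ℤᵈ` (unitary-valued) and its plaquette regularity ON THE BOXES of the two output index sets ONLY — `h52locw`,
    -- `h52loce` (B11 Thm 1 ∕ (19)–(21) TYPE, class T until node O reads it off the co-tests) — four LEVEL-FREE numbers on `α₀`
    -- (class D), the e-letter's two pin profiles with CfP's reach `r₀e` ([R]); [dict]: `k` = the slot's level ══
    (k : ℕ) (Sf Sf' Sw Sw' : Finset (B7Prop1Explicit.Site P.d × Fin P.d))
    (Ubg : GaugeField P j SU2 → B7Prop1Explicit.Site P.d → Fin P.d → 𝔸ˣ) (hUbg : ∀ V x κ, Ubg V x κ ∈ unitaryUnits 𝔸)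
    {α₀ : ℝ} (hα : 0 < α₀) (hα3 : C0 P.d * α₀ ≤ 1 / 3) (hα4 : 4 * α₀ ≤ c2' P.d P.L) (hα6 : 4 * O1cov P.d * α₀ ≤ 1 / 3)
    (h52locw : ∀ V (c : ↥Sw'),
      pdevOn (loK P.L k c.1.1) (bondHiK P.L k c.1.1 c.1.2) (Ubg V) < α₀ * (((P.L : ℝ) ^ k)⁻¹) ^ 2)
    (ιs : GaugeField P j SU2 → (𝒴 →L[ℂ] (↥Sf → 𝔸))) (hι : ∀ V Y, ‖ιs V Y‖ ≤ ‖Y‖)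
    (Hop : GaugeField P j SU2 → ((↥Sf' → 𝔸) →L[ℂ] 𝒴)) (hH : ∀ V X, ‖Hop V X‖ ≤ B₀ * ‖X‖) {ε₃ : ℝ}
    (h18 : 18 * C2cov P.d * B₀ * ε₃ ≤ 1) (hcoup : ε₄ + B₀ * (2 * dL * C₁ * ε₁) ≤ ε₃)
    (h3R : 3 * ε₃ ≤ landauRad P.d P.L) (ℓs : ι → List (𝒴 →L[ℂ] Matrix n n ℂ)) {κr : ℝ} (hκ : 0 ≤ κr)
    (hℓ : ∀ p ∈ Pu, ∀ ℓ ∈ ℓs p, ∀ Y, ‖ℓ Y‖ ≤ κr * ‖Y‖) {m : ℕ} (hlen : ∀ p ∈ Pu, (ℓs p).length ≤ m) {κc : ℝ}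
    (hκc : 0 ≤ κc) (hcurl : ∀ p ∈ Pu, ∀ Y, ‖((ℓs p).map fun ℓ => ℓ Y).sum‖ ≤ κc * ‖Y‖)
    -- ══ (T2) THE WILSON SLOT'S SUPPLIER DATA AT THE READING OF RECORD (file 4
    -- `ShellMeasureLandauWilsonSquaresKernelsSchwarz.hE_landau_wilsonSquares_located_schwarz_of_decay`, per exterior section `V`,
    -- V-uniform constants): five FLAT pi-type chain spaces, ONE pin profile on a common position space (one-sided Lipschitz),
    -- the four linear letters as V-indexed DECAY KERNELS with reduced-rate row sums ((3.133)∕Thm 3.3, (46), (103) decay-halves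
    -- TYPE — LOCATORS), the flat printed-TYPE lists, two localities with reaches, the block support of the coarse field, blind
    -- flat read-outs, the located count — NOTHING PINNED DISPLAYED; the Wilson budget LOCATED and SECOND ORDER (γ6) ══
    {Λw Λz Λb 𝔖 : Type*} [Fintype Λw] [DecidableEq Λw] [Fintype Λz] [Fintype Λb] {𝔄w ℭ 𝔇 : Type*}
    [NormedAddCommGroup 𝔄w] [NormedSpace ℂ 𝔄w] [CompleteSpace 𝔄w] [NormedAddCommGroup ℭ] [NormedSpace ℂ ℭ]
    [NormedAddCommGroup 𝔇] [NormedSpace ℂ 𝔇] {δw : ℝ} (hδw : 0 ≤ δw) (ϖw : 𝔖 → ℝ) (dis : 𝔖 → 𝔖 → ℝ)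
    (hϖw : ∀ x y, ϖw x ≤ ϖw y + dis x y) (pos : Λw → 𝔖) (posz : Λz → 𝔖) (pos' : ↥Sw → 𝔖) (posx : ↥Sw' → 𝔖)
    (posb : Λb → 𝔖) (k𝒢 : GaugeField P j SU2 → Λw → Λz → (ℭ →L[ℂ] 𝔄w))
    (kι : GaugeField P j SU2 → ↥Sw → Λw → (𝔄w →L[ℂ] 𝔸)) (kH : GaugeField P j SU2 → Λw → ↥Sw' → (𝔸 →L[ℂ] 𝔄w))
    (kH₁ : GaugeField P j SU2 → Λw → Λb → (𝔇 →L[ℂ] 𝔄w)) {c𝒢 δ𝒢 M𝒢 cι δι Mι cH δH MH cH₁ δH₁ MH₁ : ℝ} (hc𝒢 : 0 ≤ c𝒢)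
    (hM𝒢 : 0 ≤ M𝒢) (hk𝒢 : ∀ V c b', ‖k𝒢 V c b'‖ ≤ c𝒢 * Real.exp (-(δ𝒢 * dis (pos c) (posz b'))))
    (hM𝒢' : ∀ x, ∑ b', Real.exp (-((δ𝒢 - δw) * dis x (posz b'))) ≤ M𝒢) (hcι : 0 ≤ cι) (hMι : 0 ≤ Mι)
    (hkι : ∀ V c b', ‖kι V c b'‖ ≤ cι * Real.exp (-(δι * dis (pos' c) (pos b'))))
    (hMι' : ∀ x, ∑ b', Real.exp (-((δι - δw) * dis x (pos b'))) ≤ Mι) (hcH : 0 ≤ cH) (hMH : 0 ≤ MH)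
    (hkH : ∀ V c b', ‖kH V c b'‖ ≤ cH * Real.exp (-(δH * dis (pos c) (posx b'))))
    (hMH' : ∀ x, ∑ b', Real.exp (-((δH - δw) * dis x (posx b'))) ≤ MH) (hcH₁ : 0 ≤ cH₁) (hMH₁ : 0 ≤ MH₁)
    (hkH₁ : ∀ V c b', ‖kH₁ V c b'‖ ≤ cH₁ * Real.exp (-(δH₁ * dis (pos c) (posb b'))))
    (hMH₁' : ∀ x, ∑ b', Real.exp (-((δH₁ - δw) * dis x (posb b'))) ≤ MH₁)
    -- the flat lists (P2)∕(P4)∕(118)∕(121)∕(103)∕(75)-TYPE∕(44) at radius `RCw` with `6(ε₄w + B₀w·bw) ≤ RCw`∕scaling∕(46)∕(54)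
    (W𝒱w : GaugeField P j SU2 → (Λw → 𝔄w) → (Λz → ℭ)) {B₀w C₄w a₃w ε₄w bw : ℝ}
    (h𝒢w : ∀ V f, ‖kerOp (k𝒢 V) f‖ ≤ B₀w * ‖f‖) (hWw : ∀ V, Prop4Hyp (W𝒱w V) C₄w a₃w) (hB₀w : 0 < B₀w)
    (hC₄w : 0 ≤ C₄w) (hε₄w : 0 ≤ ε₄w) (hdomw : 2 * (ε₄w + B₀w * bw) ≤ a₃w)
    (hselfw : B₀w * C₄w * (ε₄w + B₀w * bw) ^ 2 ≤ ε₄w) (hcontrw : 4 * B₀w * C₄w * (ε₄w + B₀w * bw) < 1)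
    (hH₁w : ∀ V B, ‖kerOp (kH₁ V) B‖ ≤ B₀w * ‖B‖) (Φw : GaugeField P j SU2 → (Fin m₀ → ℂ) → (Λb → 𝔇)) {rΦw : ℝ}
    (hΦdw : ∀ V, DifferentiableOn ℂ (Φw V) (ball 0 rΦw)) (hΦ0w : ∀ V, Φw V 0 = 0)
    (hΦbw : ∀ V, ∀ z ∈ ball (0 : Fin m₀ → ℂ) rΦw, ‖Φw V z‖ < bw) (h2Sw : 2 * S ≤ rΦw)
    (hιw : ∀ V Y, ‖kerOp (kι V) Y‖ ≤ ‖Y‖) (hHw : ∀ V X, ‖kerOp (kH V) X‖ ≤ B₀w * ‖X‖)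
    (hqw : 9 * C2cov P.d * B₀w * (ε₄w + B₀w * bw) < 1) (hRCw : 6 * (ε₄w + B₀w * bw) ≤ landauRad P.d P.L)
    -- localities with reaches, the block support, the two contraction numbers (DISPLAYED arithmetic on the decay constants)
    (NW : Λz → Λw → Prop)
    (hlocW : ∀ V, ∀ A A' : Λw → 𝔄w, ∀ c', (∀ b', NW c' b' → A b' = A' b') → W𝒱w V A c' = W𝒱w V A' c') {rW : ℝ}
    (hreachW : ∀ c' b', NW c' b' → ϖw (posz c') - rW ≤ ϖw (pos b')) {rC : ℝ}
    (hreachC : ∀ (c' : ↥Sw') (b' : ↥Sw),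
      BondIn (loK P.L k c'.1.1) (bondHiK P.L k c'.1.1 c'.1.2) b'.1.1 b'.1.2 → ϖw (posx c') - rC ≤ ϖw (pos' b'))
    (hsupp : ∀ V, ∀ z : Fin m₀ → ℂ, ∀ i, 0 < ϖw (posb i) → Φw V z i = 0)
    (hqW : c𝒢 * M𝒢 * (4 * C₄w * (ε₄w + B₀w * bw) * Real.exp (δw * rW)) < 1)
    (hk : 12 * C2cov P.d * (ε₄w + B₀w * bw) * Real.exp (δw * rC) * (cι * Mι) * (cH * MH) < 1)
    -- weight plaquettes; read-outs BLIND off located supports, FLAT op-norms, curl op-norm (DISPLAYED; `κ_c ∝ η²`), lengths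
    {𝔭 : Type*} (Pw : Finset 𝔭) (ℓw : 𝔭 → List ((Λw → 𝔄w) →L[ℂ] Matrix n n ℂ)) (suppw : 𝔭 → Finset Λw) (ϖPw : 𝔭 → ℝ)
    (hblindw : ∀ p ∈ Pw, ∀ ℓ ∈ ℓw p, ∀ A A' : Λw → 𝔄w, (∀ b' ∈ suppw p, A b' = A' b') → ℓ A = ℓ A')
    (hdepthw : ∀ p ∈ Pw, ∀ b' ∈ suppw p, ϖPw p ≤ ϖw (pos b')) (hϖPw : ∀ p ∈ Pw, 0 ≤ ϖPw p) {κwb κcb : ℝ}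
    (hκwb : 0 ≤ κwb) (hκcb : 0 ≤ κcb) (hℓwb : ∀ p ∈ Pw, ∀ ℓ ∈ ℓw p, ‖ℓ‖ ≤ κwb) (hcurlw : ∀ p ∈ Pw, ‖(ℓw p).sum‖ ≤ κcb)
    {mw : ℕ} (hlenw : ∀ p ∈ Pw, (ℓw p).length ≤ mw)
    -- the global tuple's real structure with SKEW weight read-outs
    (𝓡𝒴w : AddSubgroup (Λw → 𝔄w)) (h𝓡𝒴w : IsClosed (𝓡𝒴w : Set (Λw → 𝔄w))) (𝓡𝒵w : AddSubgroup (Λz → ℭ))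
    (𝓡ℬw : AddSubgroup (Λb → 𝔇)) (h𝒢rw : ∀ V, ∀ f ∈ 𝓡𝒵w, kerOp (k𝒢 V) f ∈ 𝓡𝒴w) (hWrw : ∀ V, ∀ Y ∈ 𝓡𝒴w, W𝒱w V Y ∈ 𝓡𝒵w)
    (hιrw : ∀ V, ∀ Y ∈ 𝓡𝒴w, kerOp (kι V) Y ∈ skewPi ↥Sw)
    (hHrw : ∀ V, ∀ X ∈ skewPi (𝔸 := 𝔸) ↥Sw', kerOp (kH V) X ∈ 𝓡𝒴w) (hH₁rw : ∀ V, ∀ B ∈ 𝓡ℬw, kerOp (kH₁ V) B ∈ 𝓡𝒴w)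
    (hΦrw : ∀ V, ∀ y : Fin m₀ → ℝ, ‖y‖ ≤ S → Φw V (cplx y) ∈ 𝓡ℬw)
    (hskew : ∀ p ∈ Pw, ∀ ℓ ∈ ℓw p, ∀ Y ∈ 𝓡𝒴w, ℓ Y ∈ skewAdjoint (Matrix n n ℂ))
    -- the frozen background plaquettes (N-ne7cp1-g31-2) with a uniform size bound, the located count, `0 ≤ β`
    (Bp : GaugeField P j SU2 → 𝔭 → Matrix n n ℂ) {d : 𝔭 → ℝ} {dbar : ℝ}
    (hBu : ∀ V, ∀ p ∈ Pw, Bp V p ∈ unitary (Matrix n n ℂ)) (hBd : ∀ V, ∀ p ∈ Pw, ‖Bp V p - 1‖ ≤ d p)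
    (hd : ∀ p ∈ Pw, d p ≤ dbar) (hdbar : 0 ≤ dbar) {Kw : ℝ} (hKw : ∑ p ∈ Pw, Real.exp (-(δw * ϖPw p)) ≤ Kw)
    -- ══ (T3) THE LOCATED NON-WILSON TERMS — THE 𝓔-LEG READ OFF THE w-TUPLE's KERNELS IN THE PINNED DRESS (S113, leaf-01-g11:
    -- `hE_landau_chartRay_pinned_w`): ONE exponent field; the e-tuple's carriers and letters are GONE; ENTERING the pin sign, the three
    -- Schur number junctions (S108's rows, born here) and the pinned restriction row; the e-leg's own numbers, its Landau-correction
    -- pair (between the pinned spaces), the TERM rows and the coupling STAY ══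
    (hϖ0 : ∀ x, 0 ≤ ϖw x) (hB𝒢w : c𝒢 * M𝒢 ≤ B₀w) (hBH₁w : cH₁ * MH₁ ≤ B₀w) (hBHw : cH * MH ≤ B₀w) {ε₄e : ℝ}
    (hε₄e : 0 ≤ ε₄e) (hdome : 2 * (ε₄e + B₀w * bw) ≤ a₃w)
    (hselfe : B₀w * (C₄w * Real.exp (δw * rW)) * (ε₄e + B₀w * bw) ^ 2 ≤ ε₄e)
    (hcontre : 4 * B₀w * (C₄w * Real.exp (δw * rW)) * (ε₄e + B₀w * bw) < 1)
    (hιew : ∀ V, ∀ Y : WSup (pinW δw (ϖw ∘ pos)) 1 𝔄w, ‖kerOpPin (kι V) δw (ϖw ∘ pos) (ϖw ∘ pos') Y‖ ≤ ‖Y‖)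
    (hqe : 9 * (C2cov P.d * Real.exp (2 * δw * rC)) * B₀w * (ε₄e + B₀w * bw) < 1)
    (hRCe : 3 * (ε₄e + B₀w * bw) ≤ landauRad P.d P.L) {𝔱 : Type*} (I : Finset 𝔱) {Ef : 𝔱 → (Λw → 𝔄w) → ℂ} {rE : ℝ}
    {ee : 𝔱 → ℝ} (hrE : 0 < rE) (hEd : ∀ i ∈ I, DifferentiableOn ℂ (Ef i) (ball 0 rE))
    (hEb : ∀ i ∈ I, ∀ Z ∈ ball (0 : Λw → 𝔄w) rE, ‖Ef i Z‖ ≤ ee i) (he0 : ∀ i ∈ I, 0 ≤ ee i) (supp : 𝔱 → Finset Λw)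
    (hblind : ∀ i ∈ I, ∀ A₁ A₂ : Λw → 𝔄w, (∀ b' ∈ supp i, A₁ b' = A₂ b') → Ef i A₁ = Ef i A₂) (ϖP : 𝔱 → ℝ)
    (hdepth : ∀ i ∈ I, ∀ b' ∈ supp i, ϖP i ≤ ϖw (pos b')) {LK : ℝ} (hLK : 0 ≤ LK)
    (hK : ∑ i ∈ I, 2 * ee i / rE * Real.exp (-(δw * ϖP i)) ≤ LK)
    (hcoupE : ((ε₄e + B₀w * bw) + B₀w * (4 * (C2cov P.d * Real.exp (2 * δw * rC)) * (ε₄e + B₀w * bw) ^ 2)) ≤ rE / 2)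
    {BE₁ : ℝ}
    (hElb₁ : ∀ V (y : Fin m₀ → ℝ), ‖y‖ ≤ S → -BE₁ ≤
      (∑ i ∈ I, Ef i (WSup.toPiL (pinW δw (ϖw ∘ pos)) 1 (landauExp (fun Y : WSup (pinW δw (ϖw ∘ pos')) 1 𝔸 =>
            ((toPiL (pinW δw (ϖw ∘ posx)) 1).symm (landauCfBox P.L (Ubg V) k Sw Sw' (landauRad P.d P.L) (toPiL (pinW δw (ϖw ∘ pos')) 1 Y)) :
              WSup (pinW δw (ϖw ∘ posx)) 1 𝔸))
        (kerOpPin (kι V) δw (ϖw ∘ pos) (ϖw ∘ pos')) (kerOpPin (kH V) δw (ϖw ∘ posx) (ϖw ∘ pos))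
        (4 * (C2cov P.d * Real.exp (2 * δw * rC)) * (ε₄e + B₀w * bw) ^ 2)
        (solAt (kerOpPin (k𝒢 V) δw (ϖw ∘ posz) (ϖw ∘ pos)) 0
          (fun Y : WSup (pinW δw (ϖw ∘ pos)) 1 𝔄w =>
            ((toPiL (pinW δw (ϖw ∘ posz)) 1).symm (W𝒱w V (toPiL (pinW δw (ϖw ∘ pos)) 1 Y)) : WSup (pinW δw (ϖw ∘ posz)) 1 ℭ))
          ε₄e (0 : WSup (pinW δw (ϖw ∘ posz)) 1 ℭ)
          (kerOpPin (kH₁ V) δw (ϖw ∘ posb) (ϖw ∘ pos) ((toPiL (pinW δw (ϖw ∘ posb)) 1).symm (Φw V (cplx y)))) +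
            kerOpPin (kH₁ V) δw (ϖw ∘ posb) (ϖw ∘ pos) ((toPiL (pinW δw (ϖw ∘ posb)) 1).symm (Φw V (cplx y))))))).re)
    -- ══ (S78) THE FLUCTUATION-DRESSED TERMS: `−log ∫ g e^{A} dμ` with an ω-UNIFORM ray constant `B_d`, integrability and
    -- positivity of the dressed integral, a lower bound on the S-ball (all DISPLAYED) ══
    {Ω : Type*} [MeasurableSpace Ω] (μ : Measure Ω) {g : Ω → ℝ} (hg : ∀ ω, 0 ≤ g ω)
    (A : GaugeField P j SU2 → (Fin m₀ → ℝ) → Ω → ℝ) {Bd : ℝ} (hBd0 : 0 ≤ Bd)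
    (hint : ∀ V, ∀ x ∈ W V, ∀ c : ℝ, 1 / 2 ≤ c → c ≤ 1 → Integrable (fun ω => g ω * Real.exp (A V (c • x) ω)) μ)
    (hpos : ∀ V, ∀ x ∈ W V, ∀ c : ℝ, 1 / 2 ≤ c → c ≤ 1 → 0 < ∫ ω, g ω * Real.exp (A V (c • x) ω) ∂μ)
    (hA : ∀ V, ∀ x ∈ W V, ∀ c : ℝ, 1 / 2 ≤ c → c ≤ 1 → ∀ ω, A V x ω ≤ A V (c • x) ω + (1 - c) * Bd) {BE₂ : ℝ}
    (hElb₂ : ∀ V (y : Fin m₀ → ℝ), ‖y‖ ≤ S → -BE₂ ≤ (-Real.log (∫ ω, g ω * Real.exp (A V y ω) ∂μ)))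
    (L : Set (𝒴 →L[ℂ] Matrix n n ℂ)) (𝓡𝒵 : AddSubgroup 𝒵) (𝓡ℬ : AddSubgroup ℬ)
    (h𝒢r : ∀ V, ∀ f ∈ 𝓡𝒵, 𝒢 V f ∈ readOutReal L) (hWr : ∀ V, ∀ Y ∈ readOutReal L, W𝒱 V Y ∈ 𝓡𝒵)
    (hιr : ∀ V, ∀ Y ∈ readOutReal L, ιs V Y ∈ skewPi ↥Sf)
    (hHr : ∀ V, ∀ X ∈ skewPi (𝔸 := 𝔸) ↥Sf', Hop V X ∈ readOutReal L) (hH₁r : ∀ V, ∀ B ∈ 𝓡ℬ, H₁ V B ∈ readOutReal L)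
    (hΦr : ∀ V, ∀ y : Fin m₀ → ℝ, ‖y‖ ≤ S → Φ V (cplx y) ∈ 𝓡ℬ)
    (hRdict : ∀ V, ∀ x ∈ cube m₀ S, F (fixTo (combBonds lo hi) 1 (updateFinset V Λ (expFibreChart Λ 1 e x))) = Jco V
      x * ENNReal.ofReal (Real.exp (-((∑ p ∈ Pw, β * (1 - (Matrix.trace (Bp V p * holOf (ℓw p) (fun y =>
      landauExp (landauCfBox P.L (Ubg V) k Sw Sw' (landauRad P.d P.L)) (kerOp (kι V)) (kerOp (kH V)) (4 * C2cov P.d * (ε₄w + B₀w * bw) ^ 2) (solAt (kerOp (k𝒢 V)) 0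
      (W𝒱w V) ε₄w (0 : Λz → ℭ) (kerOp (kH₁ V) (Φw V (cplx y))) + kerOp (kH₁ V) (Φw V (cplx y)))) x)).re /
      Fintype.card n)) + ((∑ i ∈ I, Ef i (WSup.toPiL (pinW δw (ϖw ∘ pos)) 1 (landauExp (fun Y : WSup (pinW δw (ϖw ∘ pos')) 1 𝔸 =>
            ((toPiL (pinW δw (ϖw ∘ posx)) 1).symm (landauCfBox P.L (Ubg V) k Sw Sw' (landauRad P.d P.L) (toPiL (pinW δw (ϖw ∘ pos')) 1 Y)) :
              WSup (pinW δw (ϖw ∘ posx)) 1 𝔸)) (kerOpPin (kι V)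
      δw (ϖw ∘ pos) (ϖw ∘ pos')) (kerOpPin (kH V) δw (ϖw ∘ posx) (ϖw ∘ pos)) (4 * (C2cov P.d * Real.exp (2 * δw * rC)) * (ε₄e + B₀w * bw) ^ 2)
      (solAt (kerOpPin (k𝒢 V) δw (ϖw ∘ posz) (ϖw ∘ pos)) 0 (fun Y : WSup (pinW δw (ϖw ∘ pos)) 1 𝔄w => ((toPiL
      (pinW δw (ϖw ∘ posz)) 1).symm (W𝒱w V (toPiL (pinW δw (ϖw ∘ pos)) 1 Y)) : WSup (pinW δw (ϖw ∘ posz)) 1 ℭ))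
      ε₄e (0 : WSup (pinW δw (ϖw ∘ posz)) 1 ℭ) (kerOpPin (kH₁ V) δw (ϖw ∘ posb) (ϖw ∘ pos) ((toPiL (pinW δw (ϖw
      ∘ posb)) 1).symm (Φw V (cplx x)))) + kerOpPin (kH₁ V) δw (ϖw ∘ posb) (ϖw ∘ pos) ((toPiL (pinW δw (ϖw ∘
      posb)) 1).symm (Φw V (cplx x))))))).re + (-Real.log (∫ ω, g ω * Real.exp (A V x ω) ∂μ)))))))
    (hudict : ∀ V, ∀ x ∈ cube m₀ S,
      u (fixTo (combBonds lo hi) 1 (updateFinset V Λ (expFibreChart Λ 1 e x))) =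
        classifier hPu (fun p => holOf (ℓs p) (fun y => landauExp ((ball (0 : ↥Sf → 𝔸) (landauRad P.d P.L)).indicator
            (landauCf P.L (1 : B7Prop1Explicit.Site P.d → Fin P.d → 𝔸ˣ) k Sf Sf')) (ιs V) (Hop V)
          (4 * C2cov P.d * (ε₄ + B₀ * (2 * dL * C₁ * ε₁)) ^ 2)
          (solAt (𝒢 V) 0 (W𝒱 V) ε₄ (0 : 𝒵) (H₁ V (Φ V (cplx y))) + H₁ V (Φ V (cplx y))))) x)
    (hJW : ∀ V x, Jco V x ≠ 0 → x ∈ W V) (hJ : ∀ V x, ∀ a : ℝ, 0 ≤ a → Jco V x ≤ Jco V (Real.exp (-a) • x))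
    (hJ1 : ∀ V x, Jco V x ≤ 1) (hWS : ∀ V, W V ⊆ closedBall (0 : Fin m₀ → ℝ) S) (hδ0 : 0 ≤ δ) (hδ1 : δ < 1)
    (hρ0 : 0 ≤ ρ) (hρ : ρ ≤ (1 - δ) / 2) (hβ : 0 ≤ β)
    -- SM-L2 (SM) DISCHARGED IN THE STOKES CURRENCY (S73 `hSM_of_stokes`): the η-scalings of the classifier's read-out data
    -- DISPLAYED — curl read-out × field size `κ_c·z̄ ≤ c₁η²z` (B11 (25)∕(37) TYPE), letter size `κ_r·z̄ ≤ c₂ηz` ((19) TYPE),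
    -- regime `m·κ_r·z̄ ≤ 1` — the UNIT-currency smallness `36(c₁z + m²c₂²z²)∕(r_Φ∕S − 1)² ≤ δ·εθ`, and the classifier
    -- threshold `θ := εθ·η²` (B14 (2.17) TYPE): the `η²` CANCELS
    {η εθ c₁ c₂ z : ℝ} (hη : 0 < η) (hεθ : 0 < εθ)
    (hs₁ : κc * ((ε₄ + B₀ * (2 * dL * C₁ * ε₁)) + B₀ * (4 * C2cov P.d * (ε₄ + B₀ * (2 * dL * C₁ * ε₁)) ^ 2)) ≤ c₁ * η ^ 2 * z)
    (ha : κr * ((ε₄ + B₀ * (2 * dL * C₁ * ε₁)) + B₀ * (4 * C2cov P.d * (ε₄ + B₀ * (2 * dL * C₁ * ε₁)) ^ 2)) ≤ c₂ * η * z)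
    (hma : m * (κr * ((ε₄ + B₀ * (2 * dL * C₁ * ε₁)) + B₀ * (4 * C2cov P.d * (ε₄ + B₀ * (2 * dL * C₁ * ε₁)) ^ 2))) ≤ 1)
    (hsm : 36 * (c₁ * z + m ^ 2 * c₂ ^ 2 * z ^ 2) / (rΦ / S - 1) ^ 2 ≤ δ * εθ)
    -- THE DISPLAYED γ3 INPUT OF RECORD (N-ne7cp1-g32-2 ∕ N-ne7cp1-g33-2 «COLLAR»; leaf-01-g8 l.18489, leaf-08-g14 l.18568):
    -- radius `(d−1)·nb·a ≤ 2 sin(S∕2)`, a cover of the box plaquettes by a CORE set (⊇ the plaquettes of `□^∼`) and a COLLAR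
    -- set, and the PAIR of readings — «sub-threshold ⟹ core plaquettes `a`-small» (B14 (2.16)–(2.17) + average regularity
    -- [Balaban1985Averaging] Props 1∕2 TYPE, from `u < θ`) and «`F ≠ 0` ⟹ collar plaquettes `a`-small» (the density's KEPT
    -- co-tests, B15 (1.3)–(1.9) TYPE — a SUPPORT property); located, NOT asserted — REPLACE `hreach′` of file 1 (hence
    -- `hFsupp` of S80 f3); binder NAMES = S87 f4's (`hn hN hΛbox hΛcomb ha0 hrad hcover hcore hcollar`; the two plaquette
    -- sets are called `Pcore`∕`Pcollar` here because S80 f3 already uses `A` for the (S78) dressed action)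
    {a : ℝ} (ha0 : 0 ≤ a) (hrad : ((P.d - 1 : ℕ) : ℝ) * nb * a ≤ 2 * Real.sin (S / 2))
    {Pcore Pcollar : Set (Plaq P j)} (hcover : boxPlaqs lo hi ⊆ Pcore ∪ Pcollar)
    (hcore : ∀ (V : GaugeField P j SU2) (y : ↥Λ → SU2),
      u (fixTo (combBonds lo hi) 1 (updateFinset V Λ y)) < εθ * η ^ 2 →
        PlaqSmallOn Pcore a (fixTo (combBonds lo hi) 1 (updateFinset V Λ y)))
    (hcollar : ∀ (V : GaugeField P j SU2) (y : ↥Λ → SU2),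
      F (fixTo (combBonds lo hi) 1 (updateFinset V Λ y)) ≠ 0 →
        PlaqSmallOn Pcollar a (fixTo (combBonds lo hi) 1 (updateFinset V Λ y))) :
    SlotAntiConcentration ((fieldMeasure P j SU2).withDensity F) u (εθ * η ^ 2) ρ
      (2 * ((m₀ : ℝ) + (3 * (|β| * ((dbar +
          2 * (κcb * (cH₁ * MH₁ * bw / ((1 - c𝒢 * M𝒢 * (4 * C₄w * (ε₄w + B₀w * bw) * Real.exp (δw * rW))) *
              (1 - 12 * C2cov P.d * (ε₄w + B₀w * bw) * Real.exp (δw * rC) * (cι * Mι) * (cH * MH)))) +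
            expTail₂ (mw * (κwb * (cH₁ * MH₁ * bw / ((1 - c𝒢 * M𝒢 * (4 * C₄w * (ε₄w + B₀w * bw) * Real.exp (δw * rW))) *
              (1 - 12 * C2cov P.d * (ε₄w + B₀w * bw) * Real.exp (δw * rC) * (cι * Mι) * (cH * MH))))))) / (rΦw / S)) *
          (2 * (κcb * (cH₁ * MH₁ * bw / ((1 - c𝒢 * M𝒢 * (4 * C₄w * (ε₄w + B₀w * bw) * Real.exp (δw * rW))) *
              (1 - 12 * C2cov P.d * (ε₄w + B₀w * bw) * Real.exp (δw * rC) * (cι * Mι) * (cH * MH)))) +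
            expTail₂ (mw * (κwb * (cH₁ * MH₁ * bw / ((1 - c𝒢 * M𝒢 * (4 * C₄w * (ε₄w + B₀w * bw) * Real.exp (δw * rW))) *
              (1 - 12 * C2cov P.d * (ε₄w + B₀w * bw) * Real.exp (δw * rC) * (cι * Mι) * (cH * MH))))))) / (rΦw / S))) * Kw) +
        (3 * (LK * (2 * ((ε₄e + B₀w * bw) + B₀w * (4 * (C2cov P.d * Real.exp (2 * δw * rC)) * (ε₄e + B₀w * bw) ^ 2)))) / (rΦw / S - 1) + Bd))) / (1 - δ)) := by
  have hL2 : 2 ≤ P.L := P.hL.2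
  have hC2 : 0 ≤ C2cov P.d := by
    have hC := C1cov_pos P.d
    unfold C2cov; positivity
  have hC2e : 0 ≤ C2cov P.d * Real.exp (2 * δw * rC) := mul_nonneg hC2 (Real.exp_pos _).le
  haveI : CompleteSpace (WSup (pinW δw (ϖw ∘ posx)) 1 𝔸) := completeSpace_wsup _ 1
  have hRu := landauCorrection_real_binders_flat (𝔸 := 𝔸) (d := P.d) hL2 k Sf Sf'
  have hRw := fun V : GaugeField P j SU2 =>
    landauCfBox_real_binders_local hL2 k (Ubg V) (hUbg V) hα hα3 hα4 hα6 Sw Sw' (h52locw V)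
  -- v6 (ONE exponent field, R-ne7cp1-g37-1 (c1)): the 𝓔-leg's pinned pair IS the w-tuple's box-local pair `hRw` read through
  -- the w-tuple's OWN pins `ϖw ∘ pos'` ∕ `ϖw ∘ posx` at rate `δw` with the w-reach `hreachC` (CfP's generic conjugation, S70 f3a)
  have hRe := fun V : GaugeField P j SU2 =>
    conj_binders_of_local (𝔅 := 𝔸) hδw (fun b => hϖ0 (pos' b)) (fun c => hϖ0 (posx c))
      (fun (c' : ↥Sw') (b' : ↥Sw) => BondIn (loK P.L k c'.1.1) (bondHiK P.L k c'.1.1 c'.1.2) b'.1.1 b'.1.2)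
      (fun A A' c' h => landauCfBox_local P.L (Ubg V) k Sw Sw' (landauRad P.d P.L) A A' c' h) hreachC (C2cov_nonneg P.d)
      (hRw V).1 (hRw V).2.1
  exact 
slotAC_realized_su2_landauChart_assembled_decay_v6_of_core_collar hn hN Λ hΛbox hΛcomb e hS hSπ hF hFi hu hui hPu
    W Jco 𝒢 W𝒱 h𝒢 hW hB₀ hC₄ hε₄ hdL hC₁ hε₁ hB₃ h1 h2 h3 H₁ hH₁ Φ hΦd hΦ0 hΦ hSr (fun _ => (ball (0 : ↥Sf → 𝔸)
    (landauRad P.d P.L)).indicator       (landauCf P.L (1 : B7Prop1Explicit.Site P.d → Fin P.d → 𝔸ˣ) k Sf Sf')) hC2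
    (fun _ => hRu.1) (fun _ => hRu.2.1) ιs hι Hop hH h18 hcoup h3R ℓs hκ hℓ hlen hκc hcurl hδw ϖw dis hϖw pos posz
    pos' posx posb k𝒢 kι kH kH₁ hc𝒢 hM𝒢 hk𝒢 hM𝒢' hcι hMι hkι hMι' hcH hMH hkH hMH' hcH₁ hMH₁ hkH₁ hMH₁' W𝒱w h𝒢w hWw
    hB₀w hC₄w hε₄w hdomw hselfw hcontrw hH₁w Φw hΦdw hΦ0w hΦbw h2Sw (fun V => landauCfBox P.L (Ubg V) k Sw Sw'
    (landauRad P.d P.L)) hC2 (fun V => (hRw V).1) (fun V => (hRw V).2.1) hιw hHw hqw hRCw NW hlocW hreachW (fun (c' :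
    ↥Sw') (b' : ↥Sw) => BondIn (loK P.L k c'.1.1) (bondHiK P.L k c'.1.1 c'.1.2) b'.1.1 b'.1.2) (fun V A A' c' h =>
    landauCfBox_local P.L (Ubg V) k Sw Sw' (landauRad P.d P.L) A A' c' h) hreachC hsupp hqW hk Pw ℓw suppw ϖPw hblindw
    hdepthw hϖPw hκwb hκcb hℓwb hcurlw hlenw 𝓡𝒴w h𝓡𝒴w 𝓡𝒵w (skewPi ↥Sw) (skewPi ↥Sw') (isClosed_skewPi _) 𝓡ℬw h𝒢rw hWrw
    hιrw hHrw (fun V => (hRw V).2.2.1) hH₁rw hΦrw hskew Bp hBu hBd hd hdbar hKw hϖ0 hB𝒢w hBH₁w hBHw hε₄e hdome hselfe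
    hcontre (fun V => fun Y : WSup (pinW δw (ϖw ∘ pos')) 1 𝔸 =>       ((toPiL (pinW δw (ϖw ∘ posx)) 1).symm
    (landauCfBox P.L (Ubg V) k Sw Sw' (landauRad P.d P.L) (toPiL (pinW δw (ϖw ∘ pos')) 1 Y)) :         WSup (pinW δw
    (ϖw ∘ posx)) 1 𝔸)) hC2e (fun V => (hRe V).1) (fun V => (hRe V).2) hιew hqe hRCe I hrE hEd hEb he0 supp hblind ϖP
    hdepth hLK hK hcoupE hElb₁ μ hg A hBd0 hint hpos hA hElb₂ L 𝓡𝒵 (skewPi ↥Sf) (skewPi ↥Sf') (isClosed_skewPi _) 𝓡ℬ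
    h𝒢r hWr hιr hHr (fun _ => hRu.2.2.1) hH₁r hΦr hRdict hudict hJW hJ hJ1 hWS hδ0 hδ1 hρ0 hρ hβ hη hεθ hs₁ ha hma hsm
    ha0 hrad hcover hcore hcollar

end Box

end Summit.QuantumFields.BalabanUV.T4Continuum.ShellMeasureLandauEndAssembledDecayCfV6

end
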